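import Mathlib
import Literature.Analysis.SpecialFunctions.BesselHeatKernel
import HarnessLib

/-!
# Weber's first exponential integral for real order and the harmonic moment of the radial heat kernel

**Weber's first exponential integral** [Watson 1944, §13.3 (1); DLMF 10.43.23 / Gradshteyn–Ryzhik 6.631.4 with `J → I`]:
for `ν ≥ 0`, `a > 0`, `b ≥ 0`,
  `∫_0^∞ e^{-a z²} I_ν(b z) z^{ν+1} dz = (b/2)^ν e^{b²/(4a)} / (2 a^{ν+1})`
(`integral_exp_neg_mul_sq_mul_besselIR_mul_rpow`), proved by termwise integration of the series of `I_ν`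
(Gaussian moments `∫_0^∞ z^{2k+2ν+1} e^{-az²} dz = Γ(k+ν+1)/(2a^{k+ν+1})`, Tonelli for the nonnegative series).
Consequence for the radial heat kernel `q^{(ν)}_s(y,z) = s⁻¹ e^{-(y²+z²)/2s} I_ν(yz/s)` of `BesselHeatKernel.lean`: the function
`z ↦ z^ν` is harmonic for `L_ν = ½(∂² + z⁻¹∂) - ν²/(2z²)` and its kernel moment is conserved EXACTLY,
  `∫_0^∞ q^{(ν)}_s(y,z) z^ν · z dz = y^ν`   for every `s > 0`   (`integral_besselHeatKernel_mul_rpow`),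
the identity that yields the approximate-identity property of `q^{(ν)}_s` as `s → 0` without any large-argument
asymptotics of `I_ν` [RevuzYor1999, Ch. XI §1: `(R_t/x)^{ν}`-martingale of the Bessel process].

## References
* G. N. Watson, *A Treatise on the Theory of Bessel Functions*, 2nd ed. (1944), §13.3. [Watson1944]
* D. Revuz, M. Yor, *Continuous Martingales and Brownian Motion*, 3rd ed. (1999), Ch. XI §1. [RevuzYor1999]
* NIST DLMF §10.25, §10.43. [DLMF]
-/

noncomputable section

open Filter Topology Real MeasureTheory Set
open scoped Nat BigOperators

namespace Literature.Analysis.SpecialFunctions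

/-! ## Gaussian moments -/

/-- `∫_0^∞ z^{2k+2ν+1} e^{-a z²} dz = Γ(k+ν+1) / (2 a^{k+ν+1})` (`a > 0`, `ν ≥ 0`). [cite: DLMF, 5.9.1] -/
theorem integral_rpow_mul_exp_neg_mul_sq_Ioi {a ν : ℝ} (ha : 0 < a) (hν : 0 ≤ ν) (k : ℕ) :
    ∫ z in Ioi (0 : ℝ), z ^ (2 * (k : ℝ) + 2 * ν + 1) * Real.exp (-(a * z ^ 2)) =
      Real.Gamma (k + ν + 1) / (2 * a ^ ((k : ℝ) + ν + 1)) := by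
  have hq : -1 < 2 * (k : ℝ) + 2 * ν + 1 := by
    have : (0 : ℝ) ≤ k := Nat.cast_nonneg k
    linarith
  have h := integral_rpow_mul_exp_neg_mul_rpow (p := 2) (q := 2 * (k : ℝ) + 2 * ν + 1) two_pos hq ha
  have hfun : (fun z : ℝ => z ^ (2 * (k : ℝ) + 2 * ν + 1) * Real.exp (-a * z ^ (2 : ℝ))) =
      fun z : ℝ => z ^ (2 * (k : ℝ) + 2 * ν + 1) * Real.exp (-(a * z ^ 2)) := by
    funext z; rw [Real.rpow_two, neg_mul]
  rw [hfun] at h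
  rw [h]
  have h1 : (2 * (k : ℝ) + 2 * ν + 1 + 1) / 2 = (k : ℝ) + ν + 1 := by ring
  have h2 : -(2 * (k : ℝ) + 2 * ν + 1 + 1) / 2 = -((k : ℝ) + ν + 1) := by ring
  rw [h1, h2, Real.rpow_neg ha.le]
  field_simp

/-! ## Weber's first exponential integral -/

/-- The `k`-th term of the integrand `e^{-az²} I_ν(bz) z^{ν+1}` after expanding `I_ν`. [folklore] -/
private def weberTerm (ν a b : ℝ) (k : ℕ) (z : ℝ) : ℝ :=
  besselPCoeff ν k * (b ^ 2 / 4) ^ k * (b / 2) ^ ν * (z ^ (2 * (k : ℝ) + 2 * ν + 1) * Real.exp (-(a * z ^ 2)))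

/-- Termwise expansion of the integrand on `z > 0`. [folklore] -/
private theorem hasSum_weberTerm {ν a b z : ℝ} (hν : 0 ≤ ν) (hb : 0 ≤ b) (hz : 0 < z) :
    HasSum (fun k => weberTerm ν a b k z) (Real.exp (-(a * z ^ 2)) * besselIR ν (b * z) * z ^ (ν + 1)) := by
  unfold weberTerm besselIR
  have hP := hasSum_besselP hν ((b * z) ^ 2 / 4)
  have h1 : (b * z / 2) ^ ν = (b / 2) ^ ν * z ^ ν := by
    rw [show b * z / 2 = (b / 2) * z by ring, Real.mul_rpow (by positivity) hz.le]
  have key : ∀ k : ℕ, besselPCoeff ν k * (b ^ 2 / 4) ^ k * (b / 2) ^ ν * (z ^ (2 * (k : ℝ) + 2 * ν + 1) * Real.exp (-(a * z ^ 2)))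
      = Real.exp (-(a * z ^ 2)) * ((b / 2) ^ ν * z ^ ν) * z ^ (ν + 1) * (besselPCoeff ν k * ((b * z) ^ 2 / 4) ^ k) := by
    intro k
    have hzpow : z ^ (2 * (k : ℝ) + 2 * ν + 1) = (z ^ 2) ^ k * z ^ ν * z ^ (ν + 1) := by
      rw [show 2 * (k : ℝ) + 2 * ν + 1 = (2 * k : ℕ) + (ν + (ν + 1)) by push_cast; ring,
        Real.rpow_add hz, Real.rpow_natCast, Real.rpow_add hz, pow_mul]
      ring
    rw [hzpow, show (b * z) ^ 2 / 4 = b ^ 2 / 4 * z ^ 2 by ring, mul_pow]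
    ring
  simp_rw [key]
  rw [← h1]
  have h2 := hP.mul_left (Real.exp (-(a * z ^ 2)) * (b * z / 2) ^ ν * z ^ (ν + 1))
  have hval : Real.exp (-(a * z ^ 2)) * (b * z / 2) ^ ν * z ^ (ν + 1) * besselP ν ((b * z) ^ 2 / 4) =
      Real.exp (-(a * z ^ 2)) * ((b * z / 2) ^ ν * besselP ν ((b * z) ^ 2 / 4)) * z ^ (ν + 1) := by ring
  rw [hval] at h2
  exact h2

/-- Integrability of the terms on `(0,∞)`. [folklore] -/
private theorem integrable_weberTerm {ν a b : ℝ} (hν : 0 ≤ ν) (ha : 0 < a) (k : ℕ) :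
    Integrable (weberTerm ν a b k) (volume.restrict (Ioi 0)) := by
  unfold weberTerm
  have hq : -1 < 2 * (k : ℝ) + 2 * ν + 1 := by
    have : (0 : ℝ) ≤ k := Nat.cast_nonneg k
    linarith
  have h := integrableOn_rpow_mul_exp_neg_mul_sq ha (s := 2 * (k : ℝ) + 2 * ν + 1) hq
  have hfun : (fun z : ℝ => z ^ (2 * (k : ℝ) + 2 * ν + 1) * Real.exp (-a * z ^ 2)) =
      fun z : ℝ => z ^ (2 * (k : ℝ) + 2 * ν + 1) * Real.exp (-(a * z ^ 2)) := by
    funext z; rw [neg_mul]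
  rw [hfun] at h
  exact h.const_mul _

/-- The term integrals: `∫_0^∞ term_k = (b/2)^ν/(2a^{ν+1}) · (b²/(4a))^k/k!`. [folklore] -/
private theorem integral_weberTerm {ν a b : ℝ} (hν : 0 ≤ ν) (ha : 0 < a) (k : ℕ) :
    ∫ z in Ioi (0 : ℝ), weberTerm ν a b k z =
      (b / 2) ^ ν / (2 * a ^ (ν + 1)) * ((b ^ 2 / (4 * a)) ^ k / k !) := by
  unfold weberTerm
  rw [integral_const_mul, integral_rpow_mul_exp_neg_mul_sq_Ioi ha hν k]
  unfold besselPCoeff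
  have hG : 0 < Real.Gamma ((k : ℝ) + ν + 1) := Real.Gamma_pos_of_pos (by positivity)
  have hk : (0 : ℝ) < k ! := by exact_mod_cast Nat.factorial_pos k
  have hapow : a ^ ((k : ℝ) + ν + 1) = a ^ k * a ^ (ν + 1) := by
    rw [show (k : ℝ) + ν + 1 = (k : ℕ) + (ν + 1) by ring, Real.rpow_add ha, Real.rpow_natCast]
  rw [hapow]
  have hane : a ^ k ≠ 0 := pow_ne_zero k ha.ne'
  have hane' : a ^ (ν + 1) ≠ 0 := (Real.rpow_pos_of_pos ha _).ne'
  simp only [div_pow, mul_pow]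
  field_simp
  try ring

/-- **Weber's first exponential integral, real order**: for `ν ≥ 0`, `a > 0`, `b ≥ 0`,
`∫_0^∞ e^{-az²} I_ν(bz) z^{ν+1} dz = (b/2)^ν e^{b²/(4a)} / (2 a^{ν+1})`. [cite: Watson1944, §13.3 (1)] -/
theorem integral_exp_neg_mul_sq_mul_besselIR_mul_rpow {ν a b : ℝ} (hν : 0 ≤ ν) (ha : 0 < a) (hb : 0 ≤ b) :
    ∫ z in Ioi (0 : ℝ), Real.exp (-(a * z ^ 2)) * besselIR ν (b * z) * z ^ (ν + 1) =
      (b / 2) ^ ν * Real.exp (b ^ 2 / (4 * a)) / (2 * a ^ (ν + 1)) := by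
  -- the integrand is the sum of the terms on `(0,∞)`
  have hpt : ∫ z in Ioi (0 : ℝ), Real.exp (-(a * z ^ 2)) * besselIR ν (b * z) * z ^ (ν + 1) =
      ∫ z in Ioi (0 : ℝ), ∑' k, weberTerm ν a b k z := by
    refine setIntegral_congr_fun measurableSet_Ioi fun z hz => ?_
    exact ((hasSum_weberTerm hν hb hz).tsum_eq).symm
  rw [hpt]
  -- Tonelli / dominated summation
  have hint := fun k => integrable_weberTerm (b := b) hν ha k
  have hnorm : ∀ k, ∫ z in Ioi (0 : ℝ), ‖weberTerm ν a b k z‖ =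
      (b / 2) ^ ν / (2 * a ^ (ν + 1)) * ((b ^ 2 / (4 * a)) ^ k / k !) := by
    intro k
    rw [← integral_weberTerm hν ha k]
    refine setIntegral_congr_fun measurableSet_Ioi fun z hz => ?_
    rw [Real.norm_eq_abs, abs_of_nonneg]
    unfold weberTerm
    have := besselPCoeff_pos hν k
    have hz' : (0 : ℝ) < z := hz
    positivity
  have hexp : HasSum (fun k : ℕ => (b ^ 2 / (4 * a)) ^ k / k !) (Real.exp (b ^ 2 / (4 * a))) := by
    have h := NormedSpace.expSeries_div_hasSum_exp (b ^ 2 / (4 * a))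
    rwa [← congrFun Real.exp_eq_exp_ℝ (b ^ 2 / (4 * a))] at h
  have hsum : Summable fun k => ∫ z in Ioi (0 : ℝ), ‖weberTerm ν a b k z‖ := by
    simp_rw [hnorm]
    exact (hexp.summable).mul_left _
  rw [← integral_tsum_of_summable_integral_norm hint hsum]
  simp_rw [integral_weberTerm hν ha]
  rw [tsum_mul_left, hexp.tsum_eq]
  ring

/-! ## The harmonic moment of the radial heat kernel -/

/-- **`∫_0^∞ q^{(ν)}_s(y,z) z^ν · z dz = y^ν`** (`ν ≥ 0`, `s, y > 0`): the `L_ν`-harmonic function `z^ν` is preserved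
exactly by the radial heat kernel. [cite: RevuzYor1999, Ch. XI §1] -/
theorem integral_besselHeatKernel_mul_rpow {ν s y : ℝ} (hν : 0 ≤ ν) (hs : 0 < s) (hy : 0 < y) :
    ∫ z in Ioi (0 : ℝ), besselHeatKernel ν s y z * z ^ ν * z = y ^ ν := by
  have ha : (0 : ℝ) < 1 / (2 * s) := by positivity
  have hb : (0 : ℝ) ≤ y / s := by positivity
  have hW := integral_exp_neg_mul_sq_mul_besselIR_mul_rpow hν ha hb
  -- rewrite the kernel integrand
  have hpt : ∫ z in Ioi (0 : ℝ), besselHeatKernel ν s y z * z ^ ν * z =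
      ∫ z in Ioi (0 : ℝ), (s⁻¹ * Real.exp (-(y ^ 2) / (2 * s))) *
        (Real.exp (-(1 / (2 * s) * z ^ 2)) * besselIR ν (y / s * z) * z ^ (ν + 1)) := by
    refine setIntegral_congr_fun measurableSet_Ioi fun z hz => ?_
    have hz' : (0 : ℝ) < z := hz
    unfold besselHeatKernel
    rw [Real.rpow_add_one hz'.ne', show y * z / s = y / s * z by ring]
    have : Real.exp (-(y ^ 2 + z ^ 2) / (2 * s)) = Real.exp (-(y ^ 2) / (2 * s)) * Real.exp (-(1 / (2 * s) * z ^ 2)) := by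
      rw [← Real.exp_add]; congr 1; field_simp; ring
    rw [this]; ring
  rw [hpt, integral_const_mul, hW]
  -- simplify the constants
  have h2s : (0 : ℝ) < 2 * s := by positivity
  have e1 : (y / s) ^ 2 / (4 * (1 / (2 * s))) = y ^ 2 / (2 * s) := by field_simp; ring
  have e2 : (1 / (2 * s)) ^ (ν + 1) = ((2 * s) ^ (ν + 1))⁻¹ := by
    rw [one_div, Real.inv_rpow h2s.le]
  have e3 : (y / s / 2) ^ ν = y ^ ν / (2 * s) ^ ν := by
    rw [show y / s / 2 = y / (2 * s) by ring, Real.div_rpow hy.le h2s.le]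
  have e4 : (2 * s) ^ (ν + 1) = (2 * s) ^ ν * (2 * s) := Real.rpow_add_one h2s.ne' ν
  rw [e1, e2, e3, e4]
  have hE : Real.exp (-(y ^ 2) / (2 * s)) = (Real.exp (y ^ 2 / (2 * s)))⁻¹ := by
    rw [← Real.exp_neg]; congr 1; ring
  rw [hE]
  have hEpos : 0 < Real.exp (y ^ 2 / (2 * s)) := Real.exp_pos _
  have hpow : (0 : ℝ) < (2 * s) ^ ν := Real.rpow_pos_of_pos h2s ν
  field_simp
  try ring

end Literature.Analysis.SpecialFunctions

end
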